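import Summits.Schanuel.Schanuel.Theorems.RootDecomp1KMeasuredWallCell01

/-!
# RootDecomp1KMeasuredWallCell — lens 1, generation 38 «MEASURED WALL CELL of 33364» (the mixed wall (1, ℓ₂, ℓ₃, ρ) for every ρ in the tree class LogHyperLiouville) — continuation (RootDecomp1KMeasuredWallCell02): §3 (W) the UNIFORM 2-ADIC WINDOW ZERO ESTIMATE `window_nonvanishing` (no non-zero F ∈ ℤ[x][y] of partial degrees ≤ d and height < 2^{M!}, M ≥ d+2, vanishes at the d+1 consecutive simultaneous truncations (s³_K, s²_K))

(lens-1 g38 `RootDecomp1KMeasuredWallCell.lean` [HOME/decomp-schanuel-lens-1/g38/RootDecomp1KMeasuredWallCell.lean sha256 168ec8e8…3303, 1895 l + MWprobe 0edab326… + MWctrl b192be9d… + NODE-g38.md 03a7462f…; NOTE/CLAIM L1764, ACK + CHECKLIST K-g38 L1782, NODE L1785 / REQUEST L1786 / RESULT L1787; writer re-check L1790]; port by census-1 gen 16 in seven parts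
`RootDecomp1KMeasuredWallCell01`–`07` — see the PORT NOTE of part 01; `--supports stmt-Schanuel-33364`; rung 0.)
-/

noncomputable section

open Complex IntermediateField Polynomial
open Summit.Schanuel.Schanuel.Theorems.RootDecomp1KHyper
open Summit.Schanuel.Schanuel.Theorems.RootDecomp1KHyper.HyperCell
open Summit.Schanuel.Schanuel.Theorems.RootDecomp1KGeneric
open Summit.Schanuel.Schanuel.Theorems.RootDecomp1KRelLiouvilleCell
open Summit.Schanuel.Schanuel.Theorems.RootDecomp1KLogLogCell (LogLogLiouville logLogLiouville_of_logHyperLiouville)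
open Summit.Schanuel.Schanuel.Theorems.RootDecomp1KTwoBaseCell

namespace Summit.Schanuel.Schanuel.Theorems.RootDecomp1KMeasuredWallCell

open LiouvilleNumber
open scoped Nat

/-- `v_p` of a finite product of non-zero rationals is the sum of the valuations. -/
private theorem padicValRat_prod {p : ℕ} [Fact p.Prime] {ι : Type*} (s : Finset ι) (F : ι → ℚ)
    (hF : ∀ i ∈ s, F i ≠ 0) :
    padicValRat p (∏ i ∈ s, F i) = ∑ i ∈ s, padicValRat p (F i) := by
  classical
  induction s using Finset.induction_on with
  | empty => simp
  | insert a s ha ih =>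
    rw [Finset.prod_insert ha, Finset.sum_insert ha,
      padicValRat.mul (hF a (Finset.mem_insert_self a s))
        (Finset.prod_ne_zero_iff.mpr fun i hi => hF i (Finset.mem_insert_of_mem hi)),
      ih fun i hi => hF i (Finset.mem_insert_of_mem hi)]

/-! ## §3  (W) THE 2-ADIC WINDOW ZERO ESTIMATE at the simultaneous truncations `(s²_K, s³_K)` -/

section Window
open LiouvilleNumber
open scoped Nat

/-- Evaluation of `F ∈ ℤ[x][y]` (outer variable `y`, inner variable `x`) at `(y, x) = (y₀, x₀) ∈ ℚ²`. -/
def evxy (x₀ y₀ : ℚ) (F : ℤ[X][X]) : ℚ :=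
  (F.map (Polynomial.aeval x₀ : ℤ[X] →ₐ[ℤ] ℚ).toRingHom).eval y₀

/-- `evxy` as the `y`-expansion `Σ_i f_i(x₀) y₀^i`. -/
theorem evxy_eq_sum (x₀ y₀ : ℚ) (F : ℤ[X][X]) :
    evxy x₀ y₀ F = ∑ i ∈ Finset.range (F.natDegree + 1), Polynomial.aeval x₀ (F.coeff i) * y₀ ^ i := by
  unfold evxy
  rw [Polynomial.eval_map, Polynomial.eval₂_eq_sum_range]
  rfl

/-- `aeval x₀ f = Σ_j f_j x₀^j` over `range (natDegree f + 1)`. -/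
theorem aeval_int_eq_sum (x₀ : ℚ) (f : ℤ[X]) :
    Polynomial.aeval x₀ f = ∑ j ∈ Finset.range (f.natDegree + 1), ((f.coeff j : ℤ) : ℚ) * x₀ ^ j := by
  rw [Polynomial.aeval_eq_sum_range]
  refine Finset.sum_congr rfl fun j _ => ?_
  rw [zsmul_eq_mul]

/-- **3-adic non-vanishing.** A non-zero `f ∈ ℤ[x]` with all `|f_j| < 3^{K!}` (`K ≥ 2`) does not vanish at
`s³_K = a/3^{K!}`, `3 ∤ a`. -/
theorem aeval_psQ_three_ne_zero {f : ℤ[X]} (hf : f ≠ 0) {K : ℕ} (hK : 2 ≤ K)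
    (hsmall : ∀ j, |f.coeff j| < (3 : ℤ) ^ K !) : Polynomial.aeval (psQ 3 K) f ≠ 0 := by
  intro h0
  set J : ℕ := f.natDegree with hJ
  have hlc : f.coeff J ≠ 0 := by
    have := Polynomial.leadingCoeff_ne_zero.mpr hf
    rwa [Polynomial.leadingCoeff] at this
  rw [aeval_int_eq_sum, psQ_eq_div (by norm_num)] at h0
  have h3 : ¬ ((3 : ℕ) : ℤ) ∣ (psNumer 3 K : ℤ) := not_dvd_psNumer (by norm_num) hK
  have hval := le_padicValRat_top_of_sum_eq_zero (p := 3) h3 (K !) (D := J)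
    (fun j => ((f.coeff j : ℤ) : ℚ)) (fun j _ hj => by
      rw [padicValRat.of_int]; exact_mod_cast Nat.zero_le _) (by exact_mod_cast hlc)
    (by push_cast at h0 ⊢; exact h0)
  rw [padicValRat.of_int] at hval
  have hvalN : K ! ≤ padicValInt 3 (f.coeff J) := by exact_mod_cast hval
  have hdvd : (3 : ℤ) ^ K ! ∣ f.coeff J :=
    (padicValInt_dvd_iff (p := 3) (K !) (f.coeff J)).mpr (Or.inr hvalN)
  have hle : (3 : ℤ) ^ K ! ≤ |f.coeff J| :=
    Int.le_of_dvd (abs_pos.mpr hlc) ((dvd_abs _ _).mpr hdvd)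
  exact absurd (hsmall J) (not_lt.mpr hle)

/-- **(W) THE WINDOW ZERO ESTIMATE.** A non-zero `F ∈ ℤ[x][y]` of partial degrees `≤ d` with all
coefficients `|F_{ij}| ≤ L < 2^{M!}`, `M ≥ d + 2`, is non-zero at `(y, x) = (s²_K, s³_K)` for some `K` in the
window `[M+1, M+1+d]`.  (Uniform in `F`: the window depends on `d` and `L` only.) -/
theorem window_nonvanishing (F : ℤ[X][X]) (hF : F ≠ 0) {d M : ℕ} {L : ℤ}
    (hdegy : F.natDegree ≤ d) (hdegx : ∀ i, (F.coeff i).natDegree ≤ d)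
    (hcoef : ∀ i j, |(F.coeff i).coeff j| ≤ L) (hL : L < 2 ^ M !) (hM : d + 2 ≤ M) :
    ∃ K, M + 1 ≤ K ∧ K ≤ M + 1 + d ∧ evxy (psQ 3 K) (psQ 2 K) F ≠ 0 := by
  classical
  by_contra hall
  push Not at hall
  -- the top `y`-coefficient `f` and its leading coefficient
  set D : ℕ := F.natDegree with hD
  set f : ℤ[X] := F.coeff D with hf
  have hf0 : f ≠ 0 := by
    have := Polynomial.leadingCoeff_ne_zero.mpr hF
    rwa [Polynomial.leadingCoeff] at this
  set J : ℕ := f.natDegree with hJ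
  have hJd : J ≤ d := hdegx D
  have hlc : f.coeff J ≠ 0 := by
    have := Polynomial.leadingCoeff_ne_zero.mpr hf0
    rwa [Polynomial.leadingCoeff] at this
  -- small coefficients: `|f_j| ≤ L < 2^{M!} ≤ 2^{K!} < 3^{K!}` for `K ≥ M`
  have hsmall3 : ∀ K, M ≤ K → ∀ j, |f.coeff j| < (3 : ℤ) ^ K ! := by
    intro K hK j
    have h1 : (2 : ℤ) ^ M ! ≤ 2 ^ K ! := pow_le_pow_right₀ (by norm_num) (Nat.factorial_le hK)
    have h2 : (2 : ℤ) ^ K ! ≤ 3 ^ K ! := pow_le_pow_left₀ (by norm_num) (by norm_num) _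
    exact lt_of_le_of_lt (hcoef D j) (lt_of_lt_of_le hL (h1.trans h2))
  -- (A) 3-adic: `f(s³_K) ≠ 0` for all `K ≥ M`
  have hA : ∀ K, M ≤ K → Polynomial.aeval (psQ 3 K) f ≠ 0 := fun K hK =>
    aeval_psQ_three_ne_zero hf0 (by omega) (hsmall3 K hK)
  -- (B) 2-adic: on the window, `v₂(f(s³_K)) ≥ K!`
  have hB : ∀ K, M + 1 ≤ K → K ≤ M + 1 + d →
      ((K ! : ℕ) : ℤ) ≤ padicValRat 2 (Polynomial.aeval (psQ 3 K) f) := by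
    intro K hK1 hK2
    have hzero := hall K hK1 hK2
    rw [evxy_eq_sum, psQ_eq_div (b := 2) (by norm_num)] at hzero
    have h2 : ¬ ((2 : ℕ) : ℤ) ∣ (psNumer 2 K : ℤ) := not_dvd_psNumer (le_refl 2) (by omega)
    have hval := le_padicValRat_top_of_sum_eq_zero (p := 2) h2 (K !) (D := D)
      (fun i => Polynomial.aeval (psQ 3 K) (F.coeff i)) (fun i _ hi => by
        rw [aeval_int_eq_sum] at hi ⊢
        refine le_padicValRat_sum _ _ 0 (fun j _ hj => ?_) hi
        have hcj : ((( F.coeff i).coeff j : ℤ) : ℚ) ≠ 0 := fun h => hj (by rw [h, zero_mul])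
        have hxj : psQ 3 K ^ j ≠ 0 := fun h => hj (by rw [h, mul_zero])
        rw [padicValRat.mul hcj hxj, padicValRat.pow, padicValRat.of_int]
        have := padicValRat_psQ_three_nonneg K
        positivity) (hA K (by omega))
      (by push_cast at hzero ⊢; exact hzero)
    exact hval
  -- (C) the dyadic parameter `t`: `2^t ≤ M + 1 < 2^{t+1}`, `t ≥ 1`, `d < 2^{t+2}`, `t ≤ M`
  set t : ℕ := Nat.log 2 (M + 1) with ht
  have ht1 : 2 ^ t ≤ M + 1 := Nat.pow_log_le_self 2 (by omega)
  have ht2 : M + 1 < 2 ^ (t + 1) := Nat.lt_pow_succ_log_self (by norm_num) (M + 1)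
  have htpos : 1 ≤ t := by
    by_contra h
    have h0 : t = 0 := by omega
    rw [h0] at ht2
    norm_num at ht2
    omega
  have hd2 : d < 2 ^ (t + 2) := by
    rw [pow_succ]; omega
  have htM : t ≤ M := by
    have := Nat.lt_two_pow_self (n := t)
    omega
  -- (D) Lagrange over the `J + 1` window nodes `x_i = s³_{M+1+i}`, `i ≤ J`
  set v : ℕ → ℚ := fun i => psQ 3 (M + 1 + i) with hv
  set s : Finset ℕ := Finset.range (J + 1) with hs
  have hvs : Set.InjOn v s := by
    intro a _ b _ hab
    have := (psQ_strictMono (b := 3) (by norm_num)).injective hab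
    omega
  set fQ : ℚ[X] := f.map (Int.castRingHom ℚ) with hfQ
  have hfQdeg : fQ.natDegree = J := by
    rw [hfQ, Polynomial.natDegree_map_eq_of_injective Int.cast_injective]
  have hfQcoeff : ∀ j, fQ.coeff j = ((f.coeff j : ℤ) : ℚ) := fun j => by
    rw [hfQ, Polynomial.coeff_map]; rfl
  have hfQeval : ∀ x : ℚ, fQ.eval x = Polynomial.aeval x f := fun x => by
    rw [hfQ, Polynomial.eval_map, Polynomial.aeval_def, algebraMap_int_eq]
  have hcard : s.card = J + 1 := Finset.card_range _
  have hdeglt : fQ.degree < s.card := by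
    rw [hcard]
    refine lt_of_le_of_lt Polynomial.degree_le_natDegree ?_
    rw [hfQdeg]
    exact_mod_cast Nat.lt_succ_self J
  have hLag := Lagrange.coeff_eq_sum (v := v) hvs hdeglt
  rw [hcard, Nat.add_sub_cancel, hfQcoeff] at hLag
  -- (E) valuation of every Lagrange term is `≥ (M+1)! − J (t+1)`
  have hnode_ne : ∀ i ∈ s, fQ.eval (v i) ≠ 0 := fun i _ => by
    rw [hfQeval]; exact hA _ (by omega)
  have hden_ne : ∀ i ∈ s, ∏ j ∈ s.erase i, (v i - v j) ≠ 0 := by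
    intro i hi
    refine Finset.prod_ne_zero_iff.mpr fun j hj => sub_ne_zero.mpr fun h => ?_
    have hij : j ≠ i := (Finset.mem_erase.mp hj).1
    exact hij (hvs (Finset.mem_of_mem_erase hj) hi h.symm)
  have hdiffval : ∀ i ∈ s, ∀ j ∈ s.erase i, padicValRat 2 (v i - v j) ≤ (t : ℤ) + 1 := by
    intro i hi j hj
    have hij : j ≠ i := (Finset.mem_erase.mp hj).1
    have hi' : i ≤ J := Nat.lt_succ_iff.mp (Finset.mem_range.mp hi)
    have hj' : j ≤ J := Nat.lt_succ_iff.mp (Finset.mem_range.mp (Finset.mem_of_mem_erase hj))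
    rcases lt_or_gt_of_ne hij with hlt | hgt
    · -- j < i
      exact padicValRat_psQ_three_sub_le htpos (by omega) (by omega) (by omega)
    · rw [show v i - v j = -(v j - v i) by ring, padicValRat.neg]
      exact padicValRat_psQ_three_sub_le htpos (by omega) (by omega) (by omega)
  have hterm : ∀ i ∈ s, fQ.eval (v i) / ∏ j ∈ s.erase i, (v i - v j) ≠ 0 →
      (((M + 1)! : ℕ) : ℤ) - J * (t + 1) ≤
        padicValRat 2 (fQ.eval (v i) / ∏ j ∈ s.erase i, (v i - v j)) := by
    intro i hi _
    rw [padicValRat.div (hnode_ne i hi) (hden_ne i hi),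
      padicValRat_prod _ _ (fun j hj => sub_ne_zero.mpr fun h =>
        (Finset.mem_erase.mp hj).1 (hvs (Finset.mem_of_mem_erase hj) hi h.symm))]
    have h1 : (((M + 1)! : ℕ) : ℤ) ≤ padicValRat 2 (fQ.eval (v i)) := by
      rw [hfQeval]
      have hi' : i ≤ J := Nat.lt_succ_iff.mp (Finset.mem_range.mp hi)
      refine le_trans ?_ (hB (M + 1 + i) (by omega) (by omega))
      exact_mod_cast Nat.factorial_le (Nat.le_add_right _ _)
    have h2 : ∑ j ∈ s.erase i, padicValRat 2 (v i - v j) ≤ (J : ℤ) * (t + 1) := by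
      have hc : (s.erase i).card = J := by rw [Finset.card_erase_of_mem hi, hcard]; rfl
      calc ∑ j ∈ s.erase i, padicValRat 2 (v i - v j) ≤ ∑ _j ∈ s.erase i, ((t : ℤ) + 1) :=
            Finset.sum_le_sum fun j hj => hdiffval i hi j hj
        _ = (J : ℤ) * (t + 1) := by rw [Finset.sum_const, hc, nsmul_eq_mul]
    linarith
  have hsum_ne : ∑ i ∈ s, fQ.eval (v i) / ∏ j ∈ s.erase i, (v i - v j) ≠ 0 := by
    rw [← hLag]; exact_mod_cast hlc
  have hvlc := le_padicValRat_sum s _ _ hterm hsum_ne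
  rw [← hLag, padicValRat.of_int] at hvlc
  -- (F) but `2^{v₂(lc f)} ≤ |lc f| ≤ L < 2^{M!}`
  set w : ℕ := padicValInt 2 (f.coeff J) with hw
  have hwdvd : (2 : ℤ) ^ w ∣ f.coeff J := padicValInt_dvd (p := 2) (f.coeff J)
  have hwle : (2 : ℤ) ^ w ≤ |f.coeff J| := Int.le_of_dvd (abs_pos.mpr hlc) ((dvd_abs _ _).mpr hwdvd)
  have hwlt : (2 : ℤ) ^ w < 2 ^ M ! := lt_of_le_of_lt (hwle.trans (hcoef D J)) hL
  have hwM : w < M ! := (pow_lt_pow_iff_right₀ (by norm_num : (1 : ℤ) < 2)).mp hwlt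
  -- (G) arithmetic: `(M+1)! − J(t+1) ≥ M!` since `M·M! ≥ d(M+1) ≥ J(t+1)`
  obtain ⟨M', hM'⟩ : ∃ M', M = M' + 2 := ⟨M - 2, by omega⟩
  have hJt : J * (t + 1) ≤ M' * (M' + 3) := Nat.mul_le_mul (by omega) (by omega)
  have hsq : M' * (M' + 3) ≤ (M' + 2) * (M' + 2) := by nlinarith
  have hfac : (M' + 2) * (M' + 2) ≤ (M' + 2) * (M' + 2)! :=
    Nat.mul_le_mul_left _ (Nat.self_le_factorial _)
  have hkey : J * (t + 1) + M ! ≤ (M + 1)! := by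
    rw [Nat.factorial_succ, hM']
    have := hJt.trans (hsq.trans hfac)
    nlinarith
  have hkeyZ : (((M + 1)! : ℕ) : ℤ) - J * (t + 1) ≥ ((M ! : ℕ) : ℤ) := by
    have := (Int.ofNat_le).mpr hkey
    push_cast at this ⊢
    linarith
  have hwZ : ((M ! : ℕ) : ℤ) ≤ (w : ℤ) := hkeyZ.le.trans hvlc |>.trans (le_refl _)
  have : M ! ≤ w := by exact_mod_cast hwZ
  omega

end Window

end Summit.Schanuel.Schanuel.Theorems.RootDecomp1KMeasuredWallCell

end
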